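import Literature.Topology.FourManifolds.ArnoldRokhlinQuotient
import Literature.Topology.FourManifolds.ConjQuotientSmoothing
import HarnessLib

/-!
# The Arnold–Rokhlin quotient `X/conj` (Finashin 1996, §1 ¶2): reduction to the general existence fact

Topic `Literature/Topology/FourManifolds`; namespace `Literature.Topology.FourManifolds`. PROOFS
file accompanying `ArnoldRokhlinQuotient.lean` (the named fact
`Finashin1996_conjQuotient_exists`). This first instalment records the (trivial) reduction of
that fact — the existence of the smooth branched double quotient `X → X/σ` for an anti-holomorphic
involution `σ` WITH a real point — to the tree's general existence fact
`conjQuotient_smoothStructure_exists` (`ConjQuotientSmoothing.lean`: the same statement for every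
real structure, real points or not, with `Y` moreover compact): a real structure in the sense of
`Literature.Geometry.Kaehler.IsRealStructure` is exactly an anti-holomorphic involution, and the
extra conclusion `CompactSpace Y` is dropped. The discharge
`Finashin1996_conjQuotient_exists_holds` is to follow from
`conjQuotient_smoothStructure_exists_holds` (in preparation in sibling files: anti-holomorphic
maps are real-smooth, `σ`-adapted linearising charts, the local model, the orbit space, the
equivariant tubular charts, assembly).

## References

* [Finashin1996] S. Finashin, *Rokhlin conjecture and quotients of complex surfaces by complex
  conjugation*, J. reine angew. Math. 481 (1996) 55–71 = arXiv:dg-ga/9506007, §1 ¶2.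
* [DegtyarevKharlamov2000] A. Degtyarev, V. Kharlamov, Russian Math. Surveys 55 (2000)
  = arXiv:math/0004134, §3.2.
-/

noncomputable section

open scoped Manifold ContDiff

namespace Literature.Topology.FourManifolds

/-- **Finashin 1996 §1 ¶2 from the general Arnold–Rokhlin smoothing fact.** The existence of the
smooth branched double quotient for an anti-holomorphic involution with a real point
(`Finashin1996_conjQuotient_exists`) is the special case of `conjQuotient_smoothStructure_exists`
(Degtyarev–Kharlamov 2000 §3.2 / Finashin 1997 §1.1, no hypothesis on real points, `Y` compact):
an anti-holomorphic involution is a real structure (`IsRealStructure = IsAntiholomorphic ∧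
Involutive`), and compactness of `Y` is forgotten.
[cite: Finashin1996, §1 Introduction ¶2 (arXiv:dg-ga/9506007 p. 1)] -/
theorem Finashin1996_conjQuotient_exists_of_conjQuotient_smoothStructure_exists
    (h : conjQuotient_smoothStructure_exists) : Finashin1996_conjQuotient_exists := by
  intro X _ _ _ _ _ _ σ hσ hinv _
  obtain ⟨Y, i1, i2, i3, _, i5, i6, q, hq⟩ := h X σ ⟨hσ, hinv⟩
  exact ⟨Y, i1, i2, i3, i5, i6, q, hq⟩

end Literature.Topology.FourManifolds

end
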